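/-
Origin: expansion seat `prover-pub-hodgecm-mc-binder-2-g12-0`, handover #54 2026-08-20T05:20Z md5 ca966fee8822 (318 l.; CERTIFIED same mirror: rc 0 / 0 err / 0 warn / 38 s; `#print axioms` of continuous_thetaTop_act · smooth₃₄_wmInputCM₂g · dense₃₄_of_dense · curve₃₄_zero ⊆ trio; imports #53 + #31 `HypCensus/SmoothPin` (RUN 39) + #22 `HypCensus/SideW` (RUN 37); §1 **`continuous_thetaTop_act`** (general `WeilThetaDatum` over a `ContinuousMul` monoid: EVERY group element acts continuously on Weil's Θ-initial topology, from `Θ_{S₀Φ} = Θ_Φ ∘ r_{S₀}` alone — `UniformOnFun.precomp_uniformContinuous` on compacta; the tree's `continuous_act_const` WITHOUT its `hΘ`); §2 `isoTwistCM` (= `h_𝔸`), `pinThetaDatum Γ`, **`curve₃₄ := eW⁻¹ (h_𝔸 · eW (curveOf) · h_𝔸⁻¹)`** (the (34) curves, field `e`), `cmAdelicEquiv_curve₃₄`, **`curve₃₄_zero`** (field `e_zero`), `isoOp_eq`, `cmPairRepTwist_conj_isoOp` (`ρ(1, h y h⁻¹) ∘ isoOp = isoOp ∘ ρ(1, y)`);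 §3 `tendsto_toThetaTop_curve₃₄_ins₃₄_sub_div` (value currency, any Γ: #30 pushed through the Θ-continuous linear `isoOp`) and **`smooth₃₄_wmInputCM₂g`** = THE FIELD `smooth` of the (34) side at the W pin, CLOSED (same hypotheses as #31: `hW` only); §4 `dense₃₄_of_dense_val` / **`dense₃₄_of_dense`**: the field `dense` for `ins₃₄` FOLLOWS from the field `dense` for `ins` (`isoOp` Θ-continuous + linear, `𝒮^κ` `ρ(1,h⁻¹)`-stable; `image_closure_subset_closure_image`); ⇒ ROW 19 LEDGER = ROW 18 LEDGER field by field: e/e_zero/smooth CLOSED, omg_ins@φ₀ mod `hμ₃₄`, ins_mem mod `hκ`, dense ⟸ dense₁₂; 0 Prop-defs / 0 records; NAME LIST `HodgeCM.Model.HypCensus.smooth₃₄_wmInputCM₂g` · `HodgeCM.Model.HypCensus.dense₃₄_of_dense` · `HodgeCM.Model.HypCensus.continuous_thetaTop_act`) (`HOME/mc/pub-hodgecm-mc-binder-2/g12/pkg/HodgeCM/Model/HypCensus/Side34Smooth.lean`, md5 ca966fee8822, 318 lines);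
landed by the second packager p2 gen 3 (p2-g3) in gate run 42 as `HodgeCM/Model/HypCensus/Side34Smooth.lean` (verbatim).
-/
/-
Origin: speedrun cell pub-hodgecm, MODEL-CONSTRUCTION sub-cell, lineage mc-binder-2 (BINDER-OWNERS rows 18/19: E binders
`hyp12` / `hyp34`), seat prover-pub-hodgecm-mc-binder-2-g12-0 (gen 12), 2026-08-20.
Target in PKG: `HodgeCM/Model/HypCensus/Side34Smooth.lean` (NEW additive leaf; imports this lineage's `HypCensus/Side34Omg` and
`HypCensus/SmoothPin` (#31, RUN 39), `HypCensus/SideW` (#22, RUN 37)).  KERNEL ONLY: 0 records, nothing cited, 0 `def … : Prop`.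
-/
import Summits.HodgeConjecture.HodgeCM.Model.HypCensus.Side34Omg
import Summits.HodgeConjecture.HodgeCM.Model.HypCensus.SmoothPin
import Summits.HodgeConjecture.HodgeCM.Model.HypCensus.SideW

/-!
# Census kit (rows A12/A34): the (34) curves and the fields `e_zero`, `smooth`, `dense` transported by `ρ_η(1, isoTwist)`

Continuation of `Side34Omg`: the remaining `𝒯`-free fields of `HypSideW (W V c) c.D.jT₃₄ …` from the (12)-type census.

* §1 **`continuous_thetaTop_act`** — every group element acts CONTINUOUSLY on Weil's `Θ`-initial topology (`Θ_{S₀Φ} = Θ_Φ ∘ r_{S₀}` and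
  precomposition with the continuous right translation preserves compacta; no continuity of `Θ_Φ` needed) — the tree's `continuous_act_const`
  without its `hΘ`; `continuous_toTop_ρ` at a `wm` input;
* §2 **`curve₃₄ := y_h · curveOf · y_h⁻¹`** (`y_h = eW⁻¹(h_𝔸)`), `curve₃₄_zero`, `omgW_curve₃₄_ins₃₄` (`ω(e₃₄(s))(ins₃₄ φ) = ρ(1,h)(ω(e(s))(ins φ))`);
* §3 **`smooth₃₄_wmInputCM₂g`** — the field `smooth` for `(ins₃₄, curve₃₄)` from #31 `smooth_wmInputCM₂g` pushed through the continuous linear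
  operator `ρ(1,h)` of `ThetaTop`;
* §4 **`dense₃₄_of_dense`** — the field `dense` for `ins₃₄` from the field `dense` for `ins` (`ρ(1,h)` is `Θ`-continuous, linear, and `𝒮^κ`
  is `ρ(1,h⁻¹)`-stable).

Nothing here is a claim of PerL/QW8.  Style lint (L-notation): no `local notation`.
-/

set_option autoImplicit false

noncomputable section

open Filter Topology
open NumberField NumberField.InfinitePlace
open scoped TensorProduct Classical UniformConvergence
open MvPolynomial
open Literature.NumberTheory.Automorphic Literature.NumberTheory.Automorphic.UnitaryGroup Literature.NumberTheory.Weil1964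
open Literature.RepresentationTheory.KonnoKonno2007 Literature.RepresentationTheory.KonnoKonno2007.RealDualPair
open Literature.NumberTheory.GelbartRogawski1991 Literature.NumberTheory.GelbartRogawski1991.UnitaryDualPair
open Literature.Analysis.SegalBargmann
open HodgeCM HodgeCM.Model HodgeCM.Adelic
open HodgeCM.PerL34 HodgeCM.PerL34.ArchC HodgeCM.PerL34.Fock HodgeCM.PerL34.Fock.PrintDict
open NumberField.SeesawArchTorus

/-! ## §1 Group elements act continuously on Weil's `Θ`-initial topology -/

namespace HodgeCM.Model.HypCensus

section ThetaTop

variable {Mp : Type*} {SX : Type*} [TopologicalSpace Mp] [Mul Mp] [ContinuousMul Mp] (D : WeilThetaDatum Mp SX)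

/-- **each `S₀ ∈ Mp(X)_A` acts continuously on `S(X_A)` in the theta-initial topology**, from `Θ_{S₀Φ} = Θ_Φ ∘ r_{S₀}` alone: precomposition
with the right translation `r_{S₀}` maps compacta to compacta, hence is (uniformly) continuous on `Mp →ᵤ[compacts] ℂ`
(`UniformOnFun.precomp_uniformContinuous`).  The tree's `continuous_act_const` without the hypothesis `hΘ`. [folklore] -/
theorem continuous_thetaTop_act (hact : ∀ (S S' : Mp) (Φ : SX), D.theta (D.act S' Φ) S = D.theta Φ (S * S')) (S₀ : Mp) :
    Continuous (D.onThetaTop.act S₀) := by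
  rw [WeilThetaDatum.continuous_rng_iff]
  have hpre : Continuous fun g : Mp →ᵤ[{K : Set Mp | IsCompact K}] ℂ =>
      UniformOnFun.ofFun {K : Set Mp | IsCompact K} (UniformOnFun.toFun {K : Set Mp | IsCompact K} g ∘ fun S => S * S₀) :=
    (UniformOnFun.precomp_uniformContinuous fun K hK => hK.image (continuous_id.mul continuous_const)).continuous
  refine (hpre.comp D.continuous_theta_uniformOnFun).congr fun Φ => ?_
  show UniformOnFun.ofFun {K : Set Mp | IsCompact K} (D.theta Φ ∘ fun S => S * S₀) =
    UniformOnFun.ofFun {K : Set Mp | IsCompact K} (D.theta (D.act S₀ Φ))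
  exact congrArg _ (funext fun S => (hact S S₀ Φ).symm)

end ThetaTop

/-! ## §2 The (34) curves (value currency: `ρ_η = cmPairRepTwist`, any rational set `Γ`) -/

section Pin

variable {L : CMField} {ι₁ : L →+* ℂ} (V : HermSpace3 L ι₁) (S : StubTree.SeesawDatum L)
variable
  (hGR : (cmSplittingDatum (L : Type) finProdFinEquiv (frameD V) (frameD_real V) (frameD_ne V) (dW S) (dW_real S) (dW_ne S)).CompatibleSplitting)
  (η : CMAdelic (L : Type) (frameD V) × CMAdelic (L : Type) (dW S) →* ℂˣ)
  (hη : ∀ γU ∈ CMRat (L : Type) (frameD V), ∀ γ ∈ CMRat (L : Type) (dW S), η (γU, γ) = 1)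
  (hηc : Continuous fun p => ((η p : ℂˣ) : ℂ))
  (τ : L →+* ℂ) (T : GL (Fin 3) ℂ)
  (hT : formCongr (starRingEnd ℂ) T (V.Hm.map τ) = Literature.Geometry.ComplexHyperbolic.BallModel.J)
variable (datum : ∀ b : InfinitePlace (L : Type),
  PlaceDatum (L : Type) (frameD V) (frameD_real V) (dW S) (dW_real S) ι₁ (cmPlacesEquiv (L : Type) b))
variable (m₁ m₂ : InfinitePlace (L : Type) → ℤ)
variable (hW : (∀ j, 0 < (ι₁ ((dW S) j)).re) ∨ ∀ j, (ι₁ ((dW S) j)).re < 0)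

/-- the twist in the pin's adelic currency: `h_𝔸 ∈ CMAdelic (dW S)`. -/
abbrev isoTwistCM : CMAdelic (L : Type) (dW S) :=
  archToAdelic (↥(maximalRealSubfield L)) (L : Type) (IsCMField.complexConj L) 2 (Matrix.diagonal (dW S)) (isoTwistPin S)

/-- Weil's theta datum of the pin's representation `ρ_η` (value currency, any rational set `Γ`). -/
abbrev pinThetaDatum (Γ : Set (CMAdelic (L : Type) (frameD V) × CMAdelic (L : Type) (dW S))) :=
  repWeilThetaDatum (↥(maximalRealSubfield L)) (Fin 6)
    (cmPairRepTwist (L : Type) finProdFinEquiv (frameD V) (frameD_real V) (frameD_ne V) (dW S) (dW_real S) (dW_ne S) hGR η).toHomUnits Γ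

/-- **the (34) curves** (field `e`): the (12) census curves conjugated by `h_𝔸`, read back in `U(W)(𝔸)` through `eW⁻¹`. -/
def curve₃₄ (b : InfinitePlace (L : Type))
    (u : HypIdx (kindOf (L : Type) (frameD V) (frameD_real V) (dW S) (dW_real S) ι₁ datum b)) (s : ℝ) :
    ↥(Adelic.adelicUnitaryGroup L S.gramW) :=
  (cmAdelicEquiv (L : Type) 2 (Matrix.diagonal (dW S))).symm
    (isoTwistCM S * cmAdelicEquiv (L : Type) 2 (Matrix.diagonal (dW S)) (curveOf V S datum b u s) * (isoTwistCM S)⁻¹)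

/-- `eW (curve₃₄ s) = h_𝔸 · eW (curveOf s) · h_𝔸⁻¹`. -/
theorem cmAdelicEquiv_curve₃₄ (b : InfinitePlace (L : Type))
    (u : HypIdx (kindOf (L : Type) (frameD V) (frameD_real V) (dW S) (dW_real S) ι₁ datum b)) (s : ℝ) :
    (cmAdelicEquiv (L : Type) 2 (Matrix.diagonal (dW S)) (curve₃₄ V S datum b u s) : CMAdelic (L : Type) (dW S)) =
      isoTwistCM S * cmAdelicEquiv (L : Type) 2 (Matrix.diagonal (dW S)) (curveOf V S datum b u s) * (isoTwistCM S)⁻¹ :=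
  ContinuousMulEquiv.apply_symm_apply _ _

/-- field `e_zero` for the (34) curves. -/
theorem curve₃₄_zero (b : InfinitePlace (L : Type))
    (u : HypIdx (kindOf (L : Type) (frameD V) (frameD_real V) (dW S) (dW_real S) ι₁ datum b)) :
    curve₃₄ V S datum b u 0 = 1 := by
  have h1 : (cmAdelicEquiv (L : Type) 2 (Matrix.diagonal (dW S)) (curveOf V S datum b u 0) : CMAdelic (L : Type) (dW S)) = 1 := by
    rw [curveOf_zero]
    exact (cmAdelicEquiv (L : Type) 2 (Matrix.diagonal (dW S))).map_one
  rw [curve₃₄, h1, mul_one, mul_inv_cancel]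
  exact (cmAdelicEquiv (L : Type) 2 (Matrix.diagonal (dW S))).symm.map_one

/-- `isoOp = ρ_η(1, h_𝔸)` (the `V`-component of `archProdHom (1,h)` is `1`). -/
theorem isoOp_eq :
    isoOp V S hGR η =
      cmPairRepTwist (L : Type) finProdFinEquiv (frameD V) (frameD_real V) (frameD_ne V) (dW S) (dW_real S) (dW_ne S) hGR η
        ((1 : CMAdelic (L : Type) (frameD V)), isoTwistCM S) :=
  congrArg (cmPairRepTwist (L : Type) finProdFinEquiv (frameD V) (frameD_real V) (frameD_ne V) (dW S) (dW_real S) (dW_ne S) hGR η)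
    (Prod.ext (map_one (archToAdelic (↥(maximalRealSubfield L)) (L : Type) (IsCMField.complexConj L) 3 (Matrix.diagonal (frameD V)))) rfl)

/-- **conjugation**: `ρ_η(1, h_𝔸 y h_𝔸⁻¹) ∘ ρ_η(1, h_𝔸) = ρ_η(1, h_𝔸) ∘ ρ_η(1, y)`. -/
theorem cmPairRepTwist_conj_isoOp (y : CMAdelic (L : Type) (dW S)) (Ψ : CMSchwartz (L : Type) 6) :
    cmPairRepTwist (L : Type) finProdFinEquiv (frameD V) (frameD_real V) (frameD_ne V) (dW S) (dW_real S) (dW_ne S) hGR η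
        ((1 : CMAdelic (L : Type) (frameD V)), isoTwistCM S * y * (isoTwistCM S)⁻¹) (isoOp V S hGR η Ψ) =
      isoOp V S hGR η
        (cmPairRepTwist (L : Type) finProdFinEquiv (frameD V) (frameD_real V) (frameD_ne V) (dW S) (dW_real S) (dW_ne S) hGR η
          ((1 : CMAdelic (L : Type) (frameD V)), y) Ψ) := by
  have hp : ∀ x z : CMAdelic (L : Type) (dW S),
      ((1 : CMAdelic (L : Type) (frameD V)), x * z) = ((1 : CMAdelic (L : Type) (frameD V)), x) * (1, z) :=
    fun x z => by rw [Prod.mk_mul_mk, mul_one]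
  rw [isoOp_eq, hp, hp, map_mul, map_mul, Module.End.mul_apply, Module.End.mul_apply, ← Module.End.mul_apply _
    (cmPairRepTwist (L : Type) finProdFinEquiv (frameD V) (frameD_real V) (frameD_ne V) (dW S) (dW_real S) (dW_ne S) hGR η (1, isoTwistCM S)),
    ← map_mul, ← hp, inv_mul_cancel, Prod.mk_one_one, map_one, Module.End.one_apply]

/-! ## §3 The field `smooth` for `(ins₃₄, curve₃₄)` -/

include hηc hW in
/-- **field `smooth`, value currency, (34) side**: along `curve₃₄` every `ins₃₄ f φ` is a `C¹` vector of `ρ_η` in Weil's `Θ`-topology with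
derivative `ins₃₄ f (H^{(b)} φ)` — #30 pushed through the `Θ`-continuous linear operator `ρ_η(1, h_𝔸)`. -/
theorem tendsto_toThetaTop_curve₃₄_ins₃₄_sub_div (Γ : Set (CMAdelic (L : Type) (frameD V) × CMAdelic (L : Type) (dW S)))
    (b : InfinitePlace (L : Type)) (u : HypIdx (kindOf (L : Type) (frameD V) (frameD_real V) (dW S) (dW_real S) ι₁ datum b))
    (f : FinSB ↥(maximalRealSubfield L) (Fin 6))
    (φ : (printPlaces (InfinitePlace (L : Type)) (kindOf (L : Type) (frameD V) (frameD_real V) (dW S) (dW_real S) ι₁ datum)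
      (lamOf (L : Type) (frameD V) (frameD_real V) (dW S) (dW_real S) ι₁ datum)
      (lamOf_ne_zero (L : Type) (frameD V) (frameD_real V) (dW S) (dW_real S) ι₁ datum)
      (pinnedVacs (kindOf (L : Type) (frameD V) (frameD_real V) (dW S) (dW_real S) ι₁ datum) m₁ m₂)).F) :
    Tendsto (fun s : ℝ => ((s : ℝ) : ℂ)⁻¹ •
        ((pinThetaDatum V S hGR η Γ).toThetaTop
            (cmPairRepTwist (L : Type) finProdFinEquiv (frameD V) (frameD_real V) (frameD_ne V) (dW S) (dW_real S) (dW_ne S) hGR η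
              ((1 : CMAdelic (L : Type) (frameD V)),
                (cmAdelicEquiv (L : Type) 2 (Matrix.diagonal (dW S)) (curve₃₄ V S datum b u s) : CMAdelic (L : Type) (dW S)))
              (ins₃₄ V S hGR η datum m₁ m₂ f φ)) -
          (pinThetaDatum V S hGR η Γ).toThetaTop
            (ins₃₄ V S hGR η datum m₁ m₂ f φ)))
      (𝓝[≠] 0)
      (𝓝 ((pinThetaDatum V S hGR η Γ).toThetaTop
        (ins₃₄ V S hGR η datum m₁ m₂ f
          (hypX (InfinitePlace (L : Type)) (kindOf (L : Type) (frameD V) (frameD_real V) (dW S) (dW_real S) ι₁ datum)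
            (lamOf (L : Type) (frameD V) (frameD_real V) (dW S) (dW_real S) ι₁ datum)
            (lamOf_ne_zero (L : Type) (frameD V) (frameD_real V) (dW S) (dW_real S) ι₁ datum)
            (pinnedVacs (kindOf (L : Type) (frameD V) (frameD_real V) (dW S) (dW_real S) ι₁ datum) m₁ m₂) ⟨b, u⟩ φ)))) := by
  have hA : Continuous ((pinThetaDatum V S hGR η Γ).onThetaTop.act ((1 : CMAdelic (L : Type) (frameD V)), isoTwistCM S)) :=
    continuous_thetaTop_act (pinThetaDatum V S hGR η Γ) (fun x y Φ => repWeilThetaDatum_theta_act _ Γ Φ x y) _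
  have h12 := tendsto_toThetaTop_curveOf_ins_sub_div V S hGR η hηc Γ datum m₁ m₂ hW b u f φ
  have hlin : ∀ (c : ℂ) (X Y : CMSchwartz (L : Type) 6),
      (pinThetaDatum V S hGR η Γ).onThetaTop.act ((1 : CMAdelic (L : Type) (frameD V)), isoTwistCM S)
          (c • ((pinThetaDatum V S hGR η Γ).toThetaTop X - (pinThetaDatum V S hGR η Γ).toThetaTop Y)) =
        c • ((pinThetaDatum V S hGR η Γ).toThetaTop (isoOp V S hGR η X) - (pinThetaDatum V S hGR η Γ).toThetaTop (isoOp V S hGR η Y)) := by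
    intro c X Y
    rw [isoOp_eq]
    exact (map_smul (cmPairRepTwist (L : Type) finProdFinEquiv (frameD V) (frameD_real V) (frameD_ne V) (dW S) (dW_real S) (dW_ne S)
      hGR η ((1 : CMAdelic (L : Type) (frameD V)), isoTwistCM S)) c (X - Y)).trans (congrArg _ (map_sub _ X Y))
  have hact : ∀ X : CMSchwartz (L : Type) 6,
      (pinThetaDatum V S hGR η Γ).onThetaTop.act ((1 : CMAdelic (L : Type) (frameD V)), isoTwistCM S) ((pinThetaDatum V S hGR η Γ).toThetaTop X) =
        (pinThetaDatum V S hGR η Γ).toThetaTop (isoOp V S hGR η X) := by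
    intro X
    rw [isoOp_eq]
    rfl
  have hF : (fun s : ℝ => ((s : ℝ) : ℂ)⁻¹ •
        ((pinThetaDatum V S hGR η Γ).toThetaTop (cmPairRepTwist (L : Type) finProdFinEquiv (frameD V) (frameD_real V) (frameD_ne V) (dW S) (dW_real S) (dW_ne S) hGR η
            ((1 : CMAdelic (L : Type) (frameD V)),
              (cmAdelicEquiv (L : Type) 2 (Matrix.diagonal (dW S)) (curve₃₄ V S datum b u s) : CMAdelic (L : Type) (dW S)))
            (ins₃₄ V S hGR η datum m₁ m₂ f φ)) -
          (pinThetaDatum V S hGR η Γ).toThetaTop (ins₃₄ V S hGR η datum m₁ m₂ f φ))) =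
      ((pinThetaDatum V S hGR η Γ).onThetaTop.act ((1 : CMAdelic (L : Type) (frameD V)), isoTwistCM S)) ∘ (fun s : ℝ => ((s : ℝ) : ℂ)⁻¹ •
        ((pinThetaDatum V S hGR η Γ).toThetaTop (cmPairRepTwist (L : Type) finProdFinEquiv (frameD V) (frameD_real V) (frameD_ne V) (dW S) (dW_real S) (dW_ne S) hGR η
            ((1 : CMAdelic (L : Type) (frameD V)),
              (cmAdelicEquiv (L : Type) 2 (Matrix.diagonal (dW S)) (curveOf V S datum b u s) : CMAdelic (L : Type) (dW S)))
            (ins (L : Type) (frameD V) (frameD_real V) (frameD_ne V) (dW S) (dW_real S) (dW_ne S) ι₁ datum m₁ m₂ f φ)) -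
          (pinThetaDatum V S hGR η Γ).toThetaTop (ins (L : Type) (frameD V) (frameD_real V) (frameD_ne V) (dW S) (dW_real S) (dW_ne S) ι₁ datum m₁ m₂ f φ))) := by
    funext s
    rw [Function.comp_apply, hlin, ins₃₄_apply, cmAdelicEquiv_curve₃₄, cmPairRepTwist_conj_isoOp]
  rw [hF, ins₃₄_apply, ← hact]
  exact (hA.tendsto _).comp h12

include hW in
/-- **field `smooth` of the (34) side AT THE W PIN** (`HypSideW` currency). -/
theorem smooth₃₄_wmInputCM₂g (b : InfinitePlace (L : Type))
    (u : HypIdx (kindOf (L : Type) (frameD V) (frameD_real V) (dW S) (dW_real S) ι₁ datum b))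
    (f : FinSB ↥(maximalRealSubfield L) (Fin 6))
    (φ : (printPlaces (InfinitePlace (L : Type)) (kindOf (L : Type) (frameD V) (frameD_real V) (dW S) (dW_real S) ι₁ datum)
      (lamOf (L : Type) (frameD V) (frameD_real V) (dW S) (dW_real S) ι₁ datum)
      (lamOf_ne_zero (L : Type) (frameD V) (frameD_real V) (dW S) (dW_real S) ι₁ datum)
      (pinnedVacs (kindOf (L : Type) (frameD V) (frameD_real V) (dW S) (dW_real S) ι₁ datum) m₁ m₂)).F) :
    Tendsto (fun s : ℝ => ((s : ℝ) : ℂ)⁻¹ •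
        (toTop (wmInputCM₂g V S hGR η hη hηc τ T hT)
            (omgW (wmInputCM₂g V S hGR η hη hηc τ T hT) (curve₃₄ V S datum b u s) (ins₃₄ V S hGR η datum m₁ m₂ f φ)) -
          toTop (wmInputCM₂g V S hGR η hη hηc τ T hT) (ins₃₄ V S hGR η datum m₁ m₂ f φ)))
      (𝓝[≠] 0)
      (𝓝 (toTop (wmInputCM₂g V S hGR η hη hηc τ T hT)
        (ins₃₄ V S hGR η datum m₁ m₂ f
          (hypX (InfinitePlace (L : Type)) (kindOf (L : Type) (frameD V) (frameD_real V) (dW S) (dW_real S) ι₁ datum)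
            (lamOf (L : Type) (frameD V) (frameD_real V) (dW S) (dW_real S) ι₁ datum)
            (lamOf_ne_zero (L : Type) (frameD V) (frameD_real V) (dW S) (dW_real S) ι₁ datum)
            (pinnedVacs (kindOf (L : Type) (frameD V) (frameD_real V) (dW S) (dW_real S) ι₁ datum) m₁ m₂) ⟨b, u⟩ φ)))) := by
  dsimp only [toTop, thetaTopOf, omgW]
  rw [wmInputCM₂g_ρ_eq_of V S hGR η hη hηc τ T hT hW]
  exact tendsto_toThetaTop_curve₃₄_ins₃₄_sub_div V S hGR η hηc datum m₁ m₂ hW _ b u f φ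

/-! ## §4 The field `dense` for `ins₃₄` from the field `dense` for `ins` -/

/-- **field `dense` transported, value currency**: for a `ρ_η(1, h_𝔸⁻¹)`-stable set `SKs`, if `SKs` lies in the `Θ`-closure of the span of
the (12) inserted vectors, it lies in the `Θ`-closure of the span of the (34) inserted vectors. -/
theorem dense₃₄_of_dense_val (Γ : Set (CMAdelic (L : Type) (frameD V) × CMAdelic (L : Type) (dW S))) (SKs : Set (CMSchwartz (L : Type) 6))
    (hstab : ∀ Φ ∈ SKs, cmPairRepTwist (L : Type) finProdFinEquiv (frameD V) (frameD_real V) (frameD_ne V) (dW S) (dW_real S) (dW_ne S)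
      hGR η ((1 : CMAdelic (L : Type) (frameD V)), (isoTwistCM S)⁻¹) Φ ∈ SKs)
    (FinIdx : Type) (fOf : FinIdx → FinSB ↥(maximalRealSubfield L) (Fin 6))
    (hdense : ∀ Φ ∈ SKs,
      (pinThetaDatum V S hGR η Γ).toThetaTop Φ ∈
        closure ((pinThetaDatum V S hGR η Γ).toThetaTop ''
          (Submodule.span ℂ (Set.range fun q : FinIdx ×
            (printPlaces (InfinitePlace (L : Type)) (kindOf (L : Type) (frameD V) (frameD_real V) (dW S) (dW_real S) ι₁ datum)
              (lamOf (L : Type) (frameD V) (frameD_real V) (dW S) (dW_real S) ι₁ datum)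
              (lamOf_ne_zero (L : Type) (frameD V) (frameD_real V) (dW S) (dW_real S) ι₁ datum)
              (pinnedVacs (kindOf (L : Type) (frameD V) (frameD_real V) (dW S) (dW_real S) ι₁ datum) m₁ m₂)).F =>
            ins (L : Type) (frameD V) (frameD_real V) (frameD_ne V) (dW S) (dW_real S) (dW_ne S) ι₁ datum m₁ m₂ (fOf q.1) q.2) :
              Set (CMSchwartz (L : Type) 6))))
    (Φ : CMSchwartz (L : Type) 6) (hΦ : Φ ∈ SKs) :
    (pinThetaDatum V S hGR η Γ).toThetaTop Φ ∈
      closure ((pinThetaDatum V S hGR η Γ).toThetaTop ''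
        (Submodule.span ℂ (Set.range fun q : FinIdx ×
          (printPlaces (InfinitePlace (L : Type)) (kindOf (L : Type) (frameD V) (frameD_real V) (dW S) (dW_real S) ι₁ datum)
            (lamOf (L : Type) (frameD V) (frameD_real V) (dW S) (dW_real S) ι₁ datum)
            (lamOf_ne_zero (L : Type) (frameD V) (frameD_real V) (dW S) (dW_real S) ι₁ datum)
            (pinnedVacs (kindOf (L : Type) (frameD V) (frameD_real V) (dW S) (dW_real S) ι₁ datum) m₁ m₂)).F =>
          ins₃₄ V S hGR η datum m₁ m₂ (fOf q.1) q.2) : Set (CMSchwartz (L : Type) 6))) := by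
  -- `Φ = ρ(1,h) Ψ` with `Ψ := ρ(1,h⁻¹) Φ ∈ SKs`
  have hΨmem := hstab Φ hΦ
  have hΦΨ : Φ = isoOp V S hGR η (cmPairRepTwist (L : Type) finProdFinEquiv (frameD V) (frameD_real V) (frameD_ne V) (dW S) (dW_real S)
      (dW_ne S) hGR η ((1 : CMAdelic (L : Type) (frameD V)), (isoTwistCM S)⁻¹) Φ) := by
    have hp : ((1 : CMAdelic (L : Type) (frameD V)), isoTwistCM S) * (1, (isoTwistCM S)⁻¹) = 1 := by
      rw [Prod.mk_mul_mk, mul_one, mul_inv_cancel, Prod.mk_one_one]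
    rw [isoOp_eq, ← Module.End.mul_apply, ← map_mul, hp, map_one, Module.End.one_apply]
  have hA : Continuous ((pinThetaDatum V S hGR η Γ).onThetaTop.act ((1 : CMAdelic (L : Type) (frameD V)), isoTwistCM S)) :=
    continuous_thetaTop_act (pinThetaDatum V S hGR η Γ) (fun x y Φ => repWeilThetaDatum_theta_act _ Γ Φ x y) _
  have hact : ∀ X : CMSchwartz (L : Type) 6,
      (pinThetaDatum V S hGR η Γ).onThetaTop.act ((1 : CMAdelic (L : Type) (frameD V)), isoTwistCM S) ((pinThetaDatum V S hGR η Γ).toThetaTop X) =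
        (pinThetaDatum V S hGR η Γ).toThetaTop (isoOp V S hGR η X) := by
    intro X
    rw [isoOp_eq]
    rfl
  have h1 := image_closure_subset_closure_image hA ⟨_, hdense _ hΨmem, rfl⟩
  rw [hact, ← hΦΨ] at h1
  refine closure_mono ?_ h1
  rintro _ ⟨_, ⟨x, hx, rfl⟩, rfl⟩
  refine ⟨isoOp V S hGR η x, ?_, (hact x).symm⟩
  refine Submodule.span_induction (p := fun y _ => isoOp V S hGR η y ∈
      Submodule.span ℂ (Set.range fun q : FinIdx × _ => ins₃₄ V S hGR η datum m₁ m₂ (fOf q.1) q.2)) ?_ ?_ ?_ ?_ hx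
  · rintro _ ⟨q, rfl⟩
    exact Submodule.subset_span ⟨q, (ins₃₄_apply V S hGR η datum m₁ m₂ (fOf q.1) q.2).symm⟩
  · rw [map_zero]; exact Submodule.zero_mem _
  · intro y z _ _ hy hz; rw [map_add]; exact Submodule.add_mem _ hy hz
  · intro a y _ hy; rw [map_smul]; exact Submodule.smul_mem _ a hy

include hW in
/-- **field `dense` of the (34) side AT THE W PIN from the field `dense` of the (12) side** (`HypSideW` currency; `𝒮^κ` is `ρ(1,·)`-stable). -/
theorem dense₃₄_of_dense (FinIdx : Type) (fOf : FinIdx → FinSB ↥(maximalRealSubfield L) (Fin 6))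
    (hdense : ∀ Φ ∈ (wmInputCM₂g V S hGR η hη hηc τ T hT).SK, toTop (wmInputCM₂g V S hGR η hη hηc τ T hT) Φ ∈
      closure (toTop (wmInputCM₂g V S hGR η hη hηc τ T hT) ''
        (Submodule.span ℂ (Set.range fun q : FinIdx ×
          (printPlaces (InfinitePlace (L : Type)) (kindOf (L : Type) (frameD V) (frameD_real V) (dW S) (dW_real S) ι₁ datum)
            (lamOf (L : Type) (frameD V) (frameD_real V) (dW S) (dW_real S) ι₁ datum)
            (lamOf_ne_zero (L : Type) (frameD V) (frameD_real V) (dW S) (dW_real S) ι₁ datum)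
            (pinnedVacs (kindOf (L : Type) (frameD V) (frameD_real V) (dW S) (dW_real S) ι₁ datum) m₁ m₂)).F =>
          ins (L : Type) (frameD V) (frameD_real V) (frameD_ne V) (dW S) (dW_real S) (dW_ne S) ι₁ datum m₁ m₂ (fOf q.1) q.2) :
            Set (CMSchwartz (L : Type) 6))))
    (Φ : CMSchwartz (L : Type) 6)
    (hΦ : Φ ∈ (wmInputCM₂g V S hGR η hη hηc τ T hT).SK) :
    toTop (wmInputCM₂g V S hGR η hη hηc τ T hT) Φ ∈
      closure (toTop (wmInputCM₂g V S hGR η hη hηc τ T hT) ''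
        (Submodule.span ℂ (Set.range fun q : FinIdx ×
          (printPlaces (InfinitePlace (L : Type)) (kindOf (L : Type) (frameD V) (frameD_real V) (dW S) (dW_real S) ι₁ datum)
            (lamOf (L : Type) (frameD V) (frameD_real V) (dW S) (dW_real S) ι₁ datum)
            (lamOf_ne_zero (L : Type) (frameD V) (frameD_real V) (dW S) (dW_real S) ι₁ datum)
            (pinnedVacs (kindOf (L : Type) (frameD V) (frameD_real V) (dW S) (dW_real S) ι₁ datum) m₁ m₂)).F =>
          ins₃₄ V S hGR η datum m₁ m₂ (fOf q.1) q.2) :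
            Set (CMSchwartz (L : Type) 6))) := by
  have hstab : ∀ Ψ ∈ (wmInputCM₂g V S hGR η hη hηc τ T hT).SK,
      cmPairRepTwist (L : Type) finProdFinEquiv (frameD V) (frameD_real V) (frameD_ne V) (dW S) (dW_real S) (dW_ne S) hGR η
        ((1 : CMAdelic (L : Type) (frameD V)), (isoTwistCM S)⁻¹) Ψ ∈ (wmInputCM₂g V S hGR η hη hηc τ T hT).SK := by
    intro Ψ hΨ
    have h := (wmInputCM₂g V S hGR η hη hηc τ T hT).SK_stable (isoTwistCM S)⁻¹ Ψ hΨ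
    rw [wmInputCM₂g_ρ_eq_of V S hGR η hη hηc τ T hT hW] at h
    exact h
  dsimp only [toTop, thetaTopOf] at hdense ⊢
  rw [wmInputCM₂g_ρ_eq_of V S hGR η hη hηc τ T hT hW] at hdense ⊢
  exact dense₃₄_of_dense_val V S hGR η datum m₁ m₂ _ _ hstab FinIdx fOf hdense Φ hΦ

end Pin

end HodgeCM.Model.HypCensus

end
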